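import Summits.BirchSwinnertonDyer.Rank1Residual.X1.RankOneRoutes
import Summits.BirchSwinnertonDyer.Rank1Residual.X1.PadicSigmaThreeExistence
import Literature.NumberTheory.EllipticCurves.Greenberg1999.RankZeroEulerCharacteristicOddPrimeProofs
import HarnessLib

/-!
# X1 ∩ {r = 1}: the CLASS-LEVEL statements with the Mazur–Tate `σ` binder (A34) DISCHARGED and
# Greenberg's Thm. 4.1 DERIVED — the terminal binder list of the rank-one leaf and of class X1

HONEST FRAMING (cell `b2b-bsdres`, run/shared/lean/b2b/bsd-rank1-residual/, verbatim in every file):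
the goal of the cell is to DELETE the COMBINATION-SHAPED residual classes of the Birch–Swinnerton-Dyer
formula for ALL analytic-rank `≤ 1` elliptic curves over `ℚ` — "full BSD formula for every rank `≤ 1`
curve in class `C`" assembled STRICTLY from published theorems — so that the rank-`≤ 1` remainder
becomes exactly the CONSTRUCTION-SHAPED classes, which are TYPED (missing-input `Prop`s), NOT
attempted. This is not "finishing BSD". CLASS-OWNERS.md row "X1 (r = 1)": research route; NO CLAIM
BEYOND STATED CLASSES; no label change; the announced preprint Keller–Yin arXiv:2402.12781v2 enters ONLY
as an explicitly labelled OPEN hypothesis; nothing is booked by this file; no definition, no named fact.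

Unit `b2b-bsdres-x1a` (X1 prover A, gen 21). WHAT. The class-level theorems of the rank-one leaf
(`X1/RankOne.lean`, `X1/RankOneRoutes.lean`, x1a gen 9) display, among their PUBLISHED binders, the
Mazur–Tate sigma fact `mazur_tate_sigma_exists_odd` (registry A34: Mazur–Tate 1991 Thm. 3.1 /
Mazur–Stein–Tate 2006 Thm. 1.3, existence of the `p`-adic sigma pair at an odd good ordinary prime) and
Greenberg 1999 Thm. 4.1 `greenberg_charValue_rankZero`. The first is now a THEOREM of the tree —
`X1.PadicSigmaThree.mazur_tate_sigma_exists_odd_holds` (x1a gen 20: `p = 3` by the chart `Y = 3·x(P)`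
of the ordinary `a₂`-family and the explicit canonical `3`-isogeny, `p ≥ 5` by Blakestad–Grant) — and
the second is DERIVED in the tree from the odd-prime Perrin-Riou–Schneider fact
`Schneider1985_order_charGenerator_odd` (A35, BMS 2016 Thm. 1.7 at its printed generality `p > 2`) and
A34: `greenberg_charValue_rankZero_of_Schneider1985_odd`
(`Literature/…/Greenberg1999/RankZeroEulerCharacteristicOddPrimeProofs.lean`). This file restates
the class-level theorems with those two binders FED (primed names; statements otherwise verbatim):

* §1 route B (cyclotomic): `Leaf.bsdp_of_gvPar_of_schneider'`,
  `Leaf.mazurMainConjecture_iff_bsdp_of_schneider'`, `Leaf.bsdp_of_mazurMainConjecture_of_schneider'`,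
  `statement_of_mazurMainConjectureOnX1TypeA_of_schneiderOnLeaf'`,
  `statement_iff_forall_mazurMainConjecture_of_schneiderOnLeaf'`,
  `Leaf.mazurMainConjecture_and_bsdp_of_shaAn_unit_of_schneider'` — no `hMT`;
* §2 route A (anticyclotomic, Keller–Yin display OPEN): `Leaf.bsdp_of_not_gvPar_of_KY'`,
  `statement_of_KY_of_rankZeroStatement'` — `hGr` fed from `hS` (so these take BMS 1.7 odd INSTEAD of
  Greenberg 4.1: a swap, not a reduction, recorded because the class assembly below holds `hS` anyway);
* §3 the class: `statement_of_KY_of_schneider_typeB'` and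
  `bsdpOnClassX1_of_KY_of_rankZeroDisplay_of_schneider'` — THE WHOLE CLASS X1 (both ranks) from the two
  Keller–Yin displays (PREPRINT, explicit hypotheses), Schneider certificates at rank-one TYPE-B pairs
  only (`hSchB` at the B1 pairs, `hW4` at one admissible B1-partner of each rank-zero leaf pair), and
  EIGHT published named facts: Greenberg–Vatsal 2000 Thm. (1.3), Perrin-Riou–Schneider (BMS 1.7, odd
  `p`), Perrin-Riou 1987, modularity ×2 (`nonempty_modularParametrizationData`, `exists_isNewformOf`),
  Hoffstein–Luo 1997, Gross–Zagier I.7.3, Gross–Zagier–Kolyvagin — was TEN (x1a gen 9: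
  + Mazur–Tate `σ`, + Greenberg 4.1).

TERMINAL BINDER LIST OF THE ROW (X1-CHAIN.md §30): none of the eight is prover-sized (each is a theory:
the GV anticyclotomic-to-cyclotomic comparison, the algebraic `p`-adic BSD formula, the `p`-adic
Gross–Zagier formula, modularity, non-vanishing of quadratic twists, Gross–Zagier, Kolyvagin); the two
inputs that are NOT published theorems are exactly Keller–Yin Thms. 3.0.11 + 7.0.6 (PRE) and Schneider's
conjecture at the anomalous type-B pairs (OPEN class-wide; per pair the lane's finite certificate,
`Leaf.coeff_one_ne_zero_iff_schneider`). No class LABEL changes.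

References: `X1/RankOne.lean`, `X1/RankOneRoutes.lean` (p204637, p204810), `X1/PadicSigmaThreeExistence.lean`
(p328502), `X1/RankOneCertificateRowsSigma.lean` (p328883: the same feed for the per-pair ROW records);
HOME/b2b-bsdres-x1a/X1-CHAIN.md §17b, §29, §30; [KellerYin2024] Thm. 4.2.1 (PRE); [GreenbergVatsal2000]
Thm. (1.3); [BalakrishnanMullerStein2015] Thm. 1.7; [PerrinRiou1987] §1.4; [Wuthrich2014] Thm. 16;
[MazurSteinTate2006] Thm. 1.3; [GreenbergLNM1716] Thm. 4.1; [CastellaEtAl2021] Thms. 5.1.4, 5.3.1.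

Pure proof file: no definitions, no named facts, no `sorry`.
-/

noncomputable section

open scoped Classical MatrixGroups ModularForm

open CongruenceSubgroup WeierstrassCurve Literature.NumberTheory.EllipticCurves
  Literature.NumberTheory.EllipticCurves.ModularForms
  Literature.NumberTheory.EllipticCurves.Wuthrich2014
  Literature.NumberTheory.EllipticCurves.Rank1Residual
  Summit.BirchSwinnertonDyer.BirchSwinnertonDyer.Theorems
  Summit.BirchSwinnertonDyer.BirchSwinnertonDyer.Theorems.Rank1ResidualX1Defs
  Summit.BirchSwinnertonDyer.Rank1Residual.X1.PadicSigmaThree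

set_option autoImplicit false

namespace Summit.BirchSwinnertonDyer.Rank1Residual.X1.RankOne

variable {W : WeierstrassCurve ℚ} [W.IsGloballyMinimal] {p : ℕ} [Fact p.Prime]

/-! ### §0. The feed: Greenberg 1999 Thm. 4.1 from BMS 1.7 (odd `p`) and the `σ`-theorem -/

/-- **Greenberg's Thm. 4.1 (`greenberg_charValue_rankZero`, every odd `p`) from the single published
fact `Schneider1985_order_charGenerator_odd`** (BMS 2016 Thm. 1.7, `p > 2`), the canonical-height
existence it consumes being the tree THEOREM `mazur_tate_sigma_exists_odd_holds` (x1a gen 20).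
[cite: GreenbergLNM1716, Thm. 4.1 (p. 102)] [cite: BalakrishnanMullerStein2015, Thm. 1.7 and p. 3]
[cite: MazurSteinTate2006, Thm. 1.3] -/
theorem greenberg_charValue_rankZero_of_odd (hS : Schneider1985_order_charGenerator_odd) :
    greenberg_charValue_rankZero :=
  greenberg_charValue_rankZero_of_Schneider1985_odd hS mazur_tate_sigma_exists_odd_holds

/-! ### §1. Route B (cyclotomic) on the rank-one leaf, `σ` discharged -/

/-- **B1 from the published record, modulo the certificate — `σ` discharged**: at a leaf pair of type B
(`GVPar W p`), `BSD(E,p)` from Greenberg–Vatsal 2000 Thm. (1.3) (`hGV`), Perrin-Riou–Schneider at odd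
`p` (`hS`), Perrin-Riou 1987 (`hPR`), modularity (`hmod`), GZK (`hGZK`) and Schneider's non-degeneracy
at the pair (`hSch`); the Mazur–Tate sigma pair is `mazur_tate_sigma_exists_odd_holds`.
`Leaf.bsdp_of_gvPar_of_schneider` with `hMT` fed. [cite: GreenbergVatsal2000, Thm. (1.3)]
[cite: PerrinRiou1987, §1.4 Cor. 1.8] [cite: BalakrishnanMullerStein2015, Thm. 1.7]
[cite: MazurSteinTate2006, Thm. 1.3] -/
theorem Leaf.bsdp_of_gvPar_of_schneider' [W.IsElliptic]
    (hGV : GreenbergVatsal2000.thm13_charIdeal_eq_of_gvPar)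
    (hS : Schneider1985_order_charGenerator_odd) (hPR : perrinRiou_rankOne_leadingTerms_odd)
    (hmod : nonempty_modularParametrizationData) (hGZK : rank_eq_analyticRank_of_analyticRank_le_one)
    (h : Leaf W p) (hB : GVPar W p)
    (hSch : ∀ Dh : PAdicHeightData W p, Dh.IsCanonical → SchneiderConjecture Dh) : BSDp W p :=
  h.bsdp_of_gvPar_of_schneider hGV hS hPR mazur_tate_sigma_exists_odd_holds hmod hGZK hB hSch

/-- **On the whole leaf, modulo the certificate: Mazur's main conjecture ⟺ `BSD(E,p)` — `σ`
discharged** (Wuthrich 2014 Thm. 16 `hW16`, Perrin-Riou–Schneider `hS`, Perrin-Riou 1987 `hPR`,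
modularity `hmod`, GZK `hGZK`). `Leaf.mazurMainConjecture_iff_bsdp_of_schneider` with `hMT` fed.
[cite: Wuthrich2014, Thm. 16 (p. 393) and §6 (p. 400)] [cite: PerrinRiou1987, §1.4 Cor. 1.8]
[cite: BalakrishnanMullerStein2015, Thm. 1.7] [cite: MazurSteinTate2006, Thm. 1.3] -/
theorem Leaf.mazurMainConjecture_iff_bsdp_of_schneider' [W.IsElliptic]
    (hW16 : Wuthrich2014.charIdeal_dvd_padicLFunction) (hS : Schneider1985_order_charGenerator_odd)
    (hPR : perrinRiou_rankOne_leadingTerms_odd) (hmod : nonempty_modularParametrizationData)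
    (hGZK : rank_eq_analyticRank_of_analyticRank_le_one) (h : Leaf W p)
    (hSch : ∀ Dh : PAdicHeightData W p, Dh.IsCanonical → SchneiderConjecture Dh) :
    MazurMainConjecture W p ↔ BSDp W p :=
  h.mazurMainConjecture_iff_bsdp_of_schneider hW16 hS hPR mazur_tate_sigma_exists_odd_holds hmod hGZK hSch

/-- **Mazur's main conjecture + the certificate ⇒ `BSD(E,p)` at a leaf pair — `σ` discharged**
(Perrin-Riou–Schneider `hS`, Perrin-Riou 1987 `hPR`, modularity `hmod`, GZK `hGZK`; no Wuthrich input).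
`Leaf.bsdp_of_mazurMainConjecture_of_schneider` with `hMT` fed. [cite: PerrinRiou1987, §1.4 Cor. 1.8]
[cite: BalakrishnanMullerStein2015, Thm. 1.7] [cite: MazurSteinTate2006, Thm. 1.3] -/
theorem Leaf.bsdp_of_mazurMainConjecture_of_schneider' [W.IsElliptic]
    (hS : Schneider1985_order_charGenerator_odd) (hPR : perrinRiou_rankOne_leadingTerms_odd)
    (hmod : nonempty_modularParametrizationData) (hGZK : rank_eq_analyticRank_of_analyticRank_le_one)
    (h : Leaf W p) (hSch : ∀ Dh : PAdicHeightData W p, Dh.IsCanonical → SchneiderConjecture Dh)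
    (hMC : MazurMainConjecture W p) : BSDp W p :=
  h.bsdp_of_mazurMainConjecture_of_schneider hS hPR mazur_tate_sigma_exists_odd_holds hmod hGZK hSch hMC

/-- **Route B at class level — `σ` discharged**: the rank-one statement from x1a's typed residue
`MazurMainConjectureOnX1TypeA` (Mazur's main conjecture at the type-A anomalous pairs; unstated in
print, x1a link L10) plus `SchneiderOnLeaf`, granted Greenberg–Vatsal (`hGV`), Perrin-Riou–Schneider
(`hS`), Perrin-Riou 1987 (`hPR`), modularity (`hmod`), GZK (`hGZK`).
`statement_of_mazurMainConjectureOnX1TypeA_of_schneiderOnLeaf` with `hMT` fed.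
[cite: GreenbergVatsal2000, Thm. (1.3)] [cite: PerrinRiou1987, §1.4 Cor. 1.8]
[cite: BalakrishnanMullerStein2015, Thm. 1.7] [cite: MazurSteinTate2006, Thm. 1.3] -/
theorem statement_of_mazurMainConjectureOnX1TypeA_of_schneiderOnLeaf'
    (hA : MazurMainConjectureOnX1TypeA) (hSchL : SchneiderOnLeaf)
    (hGV : GreenbergVatsal2000.thm13_charIdeal_eq_of_gvPar)
    (hS : Schneider1985_order_charGenerator_odd) (hPR : perrinRiou_rankOne_leadingTerms_odd)
    (hmod : nonempty_modularParametrizationData) (hGZK : rank_eq_analyticRank_of_analyticRank_le_one) :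
    Statement :=
  statement_of_mazurMainConjectureOnX1TypeA_of_schneiderOnLeaf hA hSchL hGV hS hPR
    mazur_tate_sigma_exists_odd_holds hmod hGZK

/-- **The missing input of route B is EXACTLY Mazur's main conjecture on the leaf, modulo Schneider —
`σ` discharged**: granted `SchneiderOnLeaf` and the published facts Wuthrich 2014 Thm. 16 (`hW16`),
Perrin-Riou–Schneider (`hS`), Perrin-Riou 1987 (`hPR`), modularity (`hmod`), GZK (`hGZK`),
`Statement` ⟺ Mazur's main conjecture at every leaf pair.
`statement_iff_forall_mazurMainConjecture_of_schneiderOnLeaf` with `hMT` fed.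
[cite: Wuthrich2014, Thm. 16 (p. 393) and §6] [cite: PerrinRiou1987, §1.4 Cor. 1.8]
[cite: BalakrishnanMullerStein2015, Thm. 1.7] [cite: MazurSteinTate2006, Thm. 1.3] -/
theorem statement_iff_forall_mazurMainConjecture_of_schneiderOnLeaf' (hSchL : SchneiderOnLeaf)
    (hW16 : Wuthrich2014.charIdeal_dvd_padicLFunction) (hS : Schneider1985_order_charGenerator_odd)
    (hPR : perrinRiou_rankOne_leadingTerms_odd) (hmod : nonempty_modularParametrizationData)
    (hGZK : rank_eq_analyticRank_of_analyticRank_le_one) :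
    Statement ↔
    ∀ (W : WeierstrassCurve ℚ) [W.IsElliptic] [W.IsGloballyMinimal] (p : ℕ) [Fact p.Prime],
      Leaf W p → MazurMainConjecture W p :=
  statement_iff_forall_mazurMainConjecture_of_schneiderOnLeaf hSchL hW16 hS hPR
    mazur_tate_sigma_exists_odd_holds hmod hGZK

/-- **Per pair: `p ∤ #Ш(E/ℚ)_an` + certificate ⇒ BOTH Mazur's main conjecture and `BSD(E,p)` — `σ`
discharged** (Wuthrich Thm. 16, Perrin-Riou–Schneider, Perrin-Riou 1987, modularity, GZK).
`Leaf.mazurMainConjecture_and_bsdp_of_shaAn_unit_of_schneider` with `hMT` fed.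
[cite: Wuthrich2014, Thm. 16 and §6] [cite: PerrinRiou1987, §1.4 Cor. 1.8]
[cite: MazurSteinTate2006, Thm. 1.3] [cite: Miller2011LMS, Def. 1.1 (arXiv:1010.2431 p. 3)] -/
theorem Leaf.mazurMainConjecture_and_bsdp_of_shaAn_unit_of_schneider' [W.IsElliptic]
    (hW16 : Wuthrich2014.charIdeal_dvd_padicLFunction) (hS : Schneider1985_order_charGenerator_odd)
    (hPR : perrinRiou_rankOne_leadingTerms_odd) (hmod : nonempty_modularParametrizationData)
    (hGZK : rank_eq_analyticRank_of_analyticRank_le_one) (h : Leaf W p)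
    (hSch : ∀ Dh : PAdicHeightData W p, Dh.IsCanonical → SchneiderConjecture Dh)
    (hunit : ∃ q : ℚ, shaAn W = (q : ℂ) ∧ padicValRat p q = 0) :
    MazurMainConjecture W p ∧ BSDp W p :=
  h.mazurMainConjecture_and_bsdp_of_shaAn_unit_of_schneider hW16 hS hPR mazur_tate_sigma_exists_odd_holds
    hmod hGZK hSch hunit

/-! ### §2. Route A (anticyclotomic; Keller–Yin display OPEN), Greenberg 4.1 derived -/

/-- **A1 ⇐ Keller–Yin's rank-one display, plus PUBLISHED facts — Greenberg 4.1 derived**: at a leaf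
pair of type A (`¬ GVPar W p`), `BSD(E,p)` from `KellerYin2024.thm421_rankOne_display_OPEN` (`hKY`;
OPEN: Keller–Yin Thms. 3.0.11 + 7.0.6, PREPRINT), Greenberg–Vatsal (`hGV`), Perrin-Riou–Schneider at
odd `p` (`hS`, which with the `σ`-theorem yields Greenberg's Thm. 4.1 at the rank-`0` type-B twist),
modularity (`hmod`, `hmod'`), Hoffstein–Luo 1997 (`hHL`), Gross–Zagier I.7.3 (`hGZ`), GZK (`hGZK`).
`Leaf.bsdp_of_not_gvPar_of_KY` with `hGr` fed (a swap `hGr ↦ hS`, not a reduction).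
[cite: KellerYin2024, Thm. 4.2.1 and its proof (p. 22) (announced; explicit hypothesis)]
[cite: GreenbergVatsal2000, Thm. (1.3)] [cite: CastellaEtAl2021, Thms. 5.1.4, 5.3.1]
[cite: BalakrishnanMullerStein2015, Thm. 1.7] [cite: GreenbergLNM1716, Thm. 4.1 (p. 102)] -/
theorem Leaf.bsdp_of_not_gvPar_of_KY' [W.IsElliptic] (hKY : KellerYin2024.thm421_rankOne_display_OPEN)
    (hGV : GreenbergVatsal2000.thm13_charIdeal_eq_of_gvPar) (hS : Schneider1985_order_charGenerator_odd)
    (hmod : nonempty_modularParametrizationData) (hmod' : exists_isNewformOf)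
    (hHL : HoffsteinLuo1997_exists_twist_L_one_ne_zero) (hGZ : GrossZagier1986_thm_I_7_3)
    (hGZK : rank_eq_analyticRank_of_analyticRank_le_one) (h : Leaf W p) (hA : ¬ GVPar W p) :
    BSDp W p :=
  h.bsdp_of_not_gvPar_of_KY hKY hGV (greenberg_charValue_rankZero_of_odd hS) hmod hmod' hHL hGZ hGZK hA

/-- **Route A at class level — Greenberg 4.1 derived**: `RankZero.Statement` + Keller–Yin ⇒ `Statement`.
`statement_of_KY_of_rankZeroStatement` with `hGr` fed from `hS`.
[cite: KellerYin2024, Thm. 4.2.1 and its proof (p. 22) (announced; explicit hypothesis)]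
[cite: CastellaEtAl2021, Thms. 5.1.4, 5.3.1] [cite: BalakrishnanMullerStein2015, Thm. 1.7] -/
theorem statement_of_KY_of_rankZeroStatement' (hKY : KellerYin2024.thm421_rankOne_display_OPEN)
    (h0 : RankZero.Statement) (hGV : GreenbergVatsal2000.thm13_charIdeal_eq_of_gvPar)
    (hS : Schneider1985_order_charGenerator_odd) (hmod : nonempty_modularParametrizationData)
    (hmod' : exists_isNewformOf) (hHL : HoffsteinLuo1997_exists_twist_L_one_ne_zero)
    (hGZ : GrossZagier1986_thm_I_7_3) (hGZK : rank_eq_analyticRank_of_analyticRank_le_one) : Statement :=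
  statement_of_KY_of_rankZeroStatement hKY h0 hGV (greenberg_charValue_rankZero_of_odd hS) hmod hmod' hHL
    hGZ hGZK

/-! ### §3. The class: Keller–Yin displays + type-B certificates + EIGHT published binders -/

/-- **The rank-one leaf from Keller–Yin on type A and Schneider certificates on type B — EIGHT published
binders** (was ten: Mazur–Tate `σ` now `mazur_tate_sigma_exists_odd_holds`, Greenberg 4.1 now derived
from `hS`): granted `KellerYin2024.thm421_rankOne_display_OPEN` (`hKY`, PREPRINT, explicit), Schneider's
non-degeneracy at every TYPE-B leaf pair (`hSchB`; per pair a finite certificate) and the PUBLISHED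
named facts Greenberg–Vatsal (`hGV`), Perrin-Riou–Schneider (`hS`), Perrin-Riou 1987 (`hPR`), modularity
(`hmod`, `hmod'`), Hoffstein–Luo (`hHL`), Gross–Zagier I.7.3 (`hGZ`), GZK (`hGZK`): `Statement`.
`statement_of_KY_of_schneider_typeB` with `hMT` and `hGr` fed.
[cite: KellerYin2024, Thm. 4.2.1 and its proof (p. 22) (announced; explicit hypothesis)]
[cite: GreenbergVatsal2000, Thm. (1.3)] [cite: PerrinRiou1987, §1.4 Cor. 1.8]
[cite: BalakrishnanMullerStein2015, Thm. 1.7] [cite: MazurSteinTate2006, Thm. 1.3] -/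
theorem statement_of_KY_of_schneider_typeB' (hKY : KellerYin2024.thm421_rankOne_display_OPEN)
    (hSchB : ∀ (W : WeierstrassCurve ℚ) [W.IsElliptic] [W.IsGloballyMinimal] (p : ℕ) [Fact p.Prime],
      Leaf W p → GVPar W p → ∀ Dh : PAdicHeightData W p, Dh.IsCanonical → SchneiderConjecture Dh)
    (hGV : GreenbergVatsal2000.thm13_charIdeal_eq_of_gvPar) (hS : Schneider1985_order_charGenerator_odd)
    (hPR : perrinRiou_rankOne_leadingTerms_odd) (hmod : nonempty_modularParametrizationData)
    (hmod' : exists_isNewformOf) (hHL : HoffsteinLuo1997_exists_twist_L_one_ne_zero)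
    (hGZ : GrossZagier1986_thm_I_7_3) (hGZK : rank_eq_analyticRank_of_analyticRank_le_one) :
    Statement :=
  statement_of_KY_of_schneider_typeB hKY hSchB hGV (greenberg_charValue_rankZero_of_odd hS) hS hPR
    mazur_tate_sigma_exists_odd_holds hmod hmod' hHL hGZ hGZK

/-- **THE WHOLE CLASS X1 MODULO THE PREPRINT AND RANK-ONE TYPE-B CERTIFICATES — EIGHT published binders.**
Granted Keller–Yin's STATED Theorems 3.0.11 + 7.0.6 in BOTH rank configurations — the rank-one display
`KellerYin2024.thm421_rankOne_display_OPEN` (`hKY`) and its mirror `RankZeroPartner.RankZeroDisplay`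
(`hDisp`), PREPRINT, explicit hypotheses — the typed class target `BSDpOnClassX1` follows from Schneider
certificates at rank-one TYPE-B pairs ONLY (`hSchB` at the B1 leaf pairs; `hW4` at one admissible
B1-partner of each rank-zero leaf pair, eisenstein-p1's route H) and the PUBLISHED named facts
Greenberg–Vatsal 2000 Thm. (1.3) (`hGV`), Perrin-Riou–Schneider at odd `p` (`hS`, BMS 1.7), Perrin-Riou
1987 (`hPR`), modularity (`hmod`, `hmod'`), Hoffstein–Luo 1997 (`hHL`), Gross–Zagier I.7.3 (`hGZ`),
Gross–Zagier–Kolyvagin (`hGZK`). The Mazur–Tate sigma pair is the tree theorem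
`mazur_tate_sigma_exists_odd_holds`; Greenberg's Thm. 4.1 is `greenberg_charValue_rankZero_of_odd hS`.
`bsdpOnClassX1_of_KY_of_rankZeroDisplay_of_schneider` (x1a gen 9, ten binders) with two fed. NO unstated
cyclotomic main conjecture is used; no label change.
[cite: KellerYin2024, Thms. 3.0.11, 7.0.6 and proof of Thm. 4.2.1 (p. 22) (announced; explicit hypotheses)]
[cite: GreenbergVatsal2000, Thm. (1.3)] [cite: CastellaEtAl2021, Thms. 5.1.4, 5.3.1]
[cite: PerrinRiou1987, §1.4 Cor. 1.8] [cite: BalakrishnanMullerStein2015, Thm. 1.7]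
[cite: MazurSteinTate2006, Thm. 1.3] [cite: GreenbergLNM1716, Thm. 4.1 (p. 102)] -/
theorem bsdpOnClassX1_of_KY_of_rankZeroDisplay_of_schneider'
    (hKY : KellerYin2024.thm421_rankOne_display_OPEN) (hDisp : RankZeroPartner.RankZeroDisplay)
    (hW4 : ∀ (W : WeierstrassCurve ℚ) [W.IsElliptic] [W.IsGloballyMinimal] (p : ℕ) [Fact p.Prime],
      RankZero.Leaf W p → RankZeroPartner.SchneiderPartnerAt W p)
    (hSchB : ∀ (W : WeierstrassCurve ℚ) [W.IsElliptic] [W.IsGloballyMinimal] (p : ℕ) [Fact p.Prime],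
      Leaf W p → GVPar W p → ∀ Dh : PAdicHeightData W p, Dh.IsCanonical → SchneiderConjecture Dh)
    (hGV : GreenbergVatsal2000.thm13_charIdeal_eq_of_gvPar) (hS : Schneider1985_order_charGenerator_odd)
    (hPR : perrinRiou_rankOne_leadingTerms_odd) (hmod : nonempty_modularParametrizationData)
    (hmod' : exists_isNewformOf) (hHL : HoffsteinLuo1997_exists_twist_L_one_ne_zero)
    (hGZ : GrossZagier1986_thm_I_7_3) (hGZK : rank_eq_analyticRank_of_analyticRank_le_one) :
    BSDpOnClassX1 :=
  bsdpOnClassX1_of_KY_of_rankZeroDisplay_of_schneider hKY hDisp hW4 hSchB hGV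
    (greenberg_charValue_rankZero_of_odd hS) hS hPR mazur_tate_sigma_exists_odd_holds hmod hmod' hHL hGZ
    hGZK

/-- **Granted Keller–Yin, class X1 IS its rank-zero leaf — Greenberg 4.1 derived**:
`BSDpOnClassX1 ↔ RankZero.Statement`. `bsdpOnClassX1_iff_rankZeroStatement_of_KY` with `hGr` fed from `hS`.
[cite: KellerYin2024, Thm. 4.2.1 (p. 22) (announced; explicit hypothesis)]
[cite: BalakrishnanMullerStein2015, Thm. 1.7] -/
theorem bsdpOnClassX1_iff_rankZeroStatement_of_KY' (hKY : KellerYin2024.thm421_rankOne_display_OPEN)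
    (hGV : GreenbergVatsal2000.thm13_charIdeal_eq_of_gvPar) (hS : Schneider1985_order_charGenerator_odd)
    (hmod : nonempty_modularParametrizationData) (hmod' : exists_isNewformOf)
    (hHL : HoffsteinLuo1997_exists_twist_L_one_ne_zero) (hGZ : GrossZagier1986_thm_I_7_3)
    (hGZK : rank_eq_analyticRank_of_analyticRank_le_one) : BSDpOnClassX1 ↔ RankZero.Statement :=
  bsdpOnClassX1_iff_rankZeroStatement_of_KY hKY hGV (greenberg_charValue_rankZero_of_odd hS) hmod hmod'
    hHL hGZ hGZK

end Summit.BirchSwinnertonDyer.Rank1Residual.X1.RankOne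

end
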